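import Literature.Topology.FourManifolds.TrisectionsFaceAmbient
import Literature.Topology.FourManifolds.TrisectionsFaceNormalForm
import Literature.Topology.FourManifolds.TrisectionsSectorNormalForm
import HarnessLib

/-!
# The normal form of a face from Gay–Kirby's face clause

Topic `Literature/Topology/FourManifolds`; infrastructure for the fact seat
`provefact-Literature.Topology.FourManifolds.exists-14560f9fc8` (named fact (c′)
`Literature.Topology.FourManifolds.exists_stabilized_gkTrisection`, Gay–Kirby 2016, Def. 8 and
Lemma 10).  Everything in this file is **proved**; no definitions, no named facts.

**Theorem (`exists_faceNormalForm`).**  *Let `Q ⊆ X` be the image of a smooth embedding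
`h : H → X` of a compact `3`-manifold with boundary carrying a handle decomposition with counts
`c` (clause (iii) of `IsGKTrisection`), with `h(∂H) = F`, and suppose that in an open `U ⊇ F`
the face is `{u_a = 0, 0 ≤ v_a}` and `F = {u_a = v_a = 0}` for smooth global `u_a, v_a`, with
corner-slice charts of the sector along `F` (the normal form of the adjacent sector).  Then
`Q` is a face in normal form, `FaceNormalForm Q F u_a v_a U c`
(`TrisectionsFaceNormalForm.lean`).*  The boundary slice atlas consists of the permuted
corner-slice charts at the points of `F` and of the immersion charts elsewhere
(`TrisectionsFaceCharts.lean`); the ambient function is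
`G = θ (1 - v_a · λ) + (1 - θ) G₁` with `G₁ ∘ h = f` the extended adapted Morse function and
`λ` the glued collar coefficient (`TrisectionsFaceAmbient.lean`), so that `G ∘ h = f` exactly
and `G = 1 - v_a · λ` near `F`; the Morse data of `G|Q` are those of `f`
(`morseData_face_transport`) and `G|Q` is regular along `F` (`not_isMCriticalPt_face_boundary`).

## References

* D. Gay, R. Kirby, *Trisecting 4-manifolds*, Geom. Topol. 20 (2016), Def. 1, Def. 8,
  Lemma 10. [GayKirby2016]
* J. M. Lee, *Introduction to Smooth Manifolds* (2013), Thm. 5.51. [LeeSmoothManifolds2013]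
* J. Milnor, *Lectures on the h-cobordism theorem* (1965), Def. 3.1. [MilnorHCobordism1965]
-/

open scoped Manifold ContDiff Topology Classical
open Set Function Filter

noncomputable section

namespace Literature.Topology.FourManifolds

universe u

section FaceFromGK

variable {X : Type u} [TopologicalSpace X] [T2Space X] [CompactSpace X]
  [ChartedSpace (EuclideanSpace ℝ (Fin 4)) X] [IsManifold (𝓡 4) ∞ X]
  {H : Type u} [TopologicalSpace H] [ChartedSpace (EuclideanHalfSpace 3) H]
  [IsManifold (𝓡∂ 3) ∞ H] [CompactSpace H]

/-- **The normal form of a face from the face clause.**  See the module docstring.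
[cite: GayKirby2016, Def. 1; LeeSmoothManifolds2013, Thm. 5.51; MilnorHCobordism1965, Def. 3.1] -/
theorem exists_faceNormalForm {U : Set X} (hUo : IsOpen U) {ua va : X → ℝ}
    (huas : ContMDiff (𝓡 4) 𝓘(ℝ, ℝ) ∞ ua) (hvas : ContMDiff (𝓡 4) 𝓘(ℝ, ℝ) ∞ va)
    {F Q Sa : Set X} {ρ : X → X} (hFc : IsCompact F) (hFU : F ⊆ U)
    (hmemF : ∀ y ∈ U, y ∈ F ↔ ua y = 0 ∧ va y = 0) (hQU : ∀ y ∈ U, y ∈ Q ↔ ua y = 0 ∧ 0 ≤ va y)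
    (hcorner : ∀ x ∈ F, ∃ C : CornerSliceChart Sa F ua va ρ, x ∈ C.Θ.source ∧ C.Θ.source ⊆ U)
    {h : H → X} (hemb : Manifold.IsSmoothEmbedding (𝓡∂ 3) (𝓡 4) ∞ h) (hrange : range h = Q)
    (hbd : h '' (𝓡∂ 3).boundary H = F) {c : ℕ → ℕ} (hHD : HasHandleDecomposition 2 H c) :
    FaceNormalForm Q F ua va U c := by
  obtain ⟨f, hf, hcount⟩ := hHD
  have he : Topology.IsEmbedding h := hemb.isEmbedding
  have himm : ∀ w, Manifold.IsImmersionAt (𝓡∂ 3) (𝓡 4) ∞ h w := fun w => hemb.isImmersion.isImmersionAt w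
  have hhs : ContMDiff (𝓡∂ 3) (𝓡 4) ∞ h := fun w => (himm w).contMDiffAt
  have hcont : Continuous h := he.continuous
  have hinj : Injective h := he.injective
  have hQc : IsCompact Q := by rw [← hrange]; exact isCompact_range hcont
  have hQcl : IsClosed Q := hQc.isClosed
  have hFQ : F ⊆ Q := by rw [← hbd, ← hrange]; exact image_subset_range _ _
  have hfs : ContMDiff (𝓡∂ 3) 𝓘(ℝ, ℝ) ∞ f := hf.1.1
  -- boundary points of `H` versus `F`
  have hbdF : ∀ w, (𝓡∂ 3).IsBoundaryPoint w ↔ h w ∈ F := by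
    intro w
    rw [← hbd]
    constructor
    · intro hw; exact ⟨w, hw, rfl⟩
    · rintro ⟨w', hw', hww'⟩; rw [← hinj hww']; exact hw'
  have hintF : ∀ w, h w ∉ F → (𝓡∂ 3).IsInteriorPoint w := fun w hw =>
    ((𝓡∂ 3).isInteriorPoint_or_isBoundaryPoint w).resolve_right fun hb => hw ((hbdF w).1 hb)
  -- ### the extended Morse function `G₁`
  obtain ⟨G₁, hG₁s, hG₁f⟩ :=
    exists_contMDiff_extension_face_global he (by rw [hrange]; exact hQcl) himm hfs
  have hG₁F : ∀ y ∈ F, G₁ y = 1 := by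
    intro y hy
    obtain ⟨w, hw, rfl⟩ : y ∈ h '' (𝓡∂ 3).boundary H := by rw [hbd]; exact hy
    rw [hG₁f w]; exact (hf.2.1 w hw).1
  have hG₁lt : ∀ y ∈ Q, y ∉ F → G₁ y < 1 := by
    intro y hyQ hyF
    obtain ⟨w, rfl⟩ : y ∈ range h := by rw [hrange]; exact hyQ
    rw [hG₁f w]; exact hf.2.2 w (hintF w hyF)
  have hvaF : ∀ y ∈ F, va y = 0 := fun y hy => ((hmemF y (hFU hy)).1 hy).2
  -- ### the collar coefficient and the ambient function
  obtain ⟨lam, Ol, hlams, hOlo, hFOl, hOlU, hlampos, hid⟩ :=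
    exists_faceCollar hUo hvas hFc hFU hQcl hmemF hQU hcorner hG₁s hG₁F hG₁lt
      (face_collar_regular hhs hrange hbd hf hG₁f hvas hvaF)
  obtain ⟨O₂, hO₂o, hFO₂, hclO₂⟩ := normal_exists_closure_subset hFc.isClosed hOlo hFOl
  obtain ⟨θ, hθ0, hθ1, -⟩ := exists_contMDiffMap_zero_one_of_isClosed (I := 𝓡 4) (n := ⊤)
    hOlo.isClosed_compl isClosed_closure
    (Set.disjoint_left.2 fun y hy hy' => hy (hclO₂ hy'))
  set G : X → ℝ := fun y => θ y * (1 - va y * lam y) + (1 - θ y) * G₁ y with hGdef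
  have hGs : ContMDiff (𝓡 4) 𝓘(ℝ, ℝ) ∞ G :=
    (θ.contMDiff.mul (contMDiff_const.sub (hvas.mul hlams))).add
      ((contMDiff_const.sub θ.contMDiff).mul hG₁s)
  have hGO₂ : ∀ y ∈ O₂, G y = 1 - va y * lam y := by
    intro y hy
    have : θ y = 1 := hθ1 (subset_closure hy)
    simp only [hGdef, this, one_mul, sub_self, zero_mul, add_zero]
  have hGh : ∀ w, G (h w) = f w := by
    intro w
    have hyQ : h w ∈ Q := hrange ▸ mem_range_self w
    by_cases hyOl : h w ∈ Ol
    · have h1 := hid (h w) ⟨hyQ, hyOl⟩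
      simp only [hGdef, ← h1, hG₁f w]; ring
    · have : θ (h w) = 0 := hθ0 hyOl
      simp only [hGdef, this, zero_mul, zero_add, sub_zero, one_mul, hG₁f w]
  have hGlt : ∀ y ∈ Q, y ∉ F → G y < 1 := by
    intro y hyQ hyF
    obtain ⟨w, rfl⟩ : y ∈ range h := by rw [hrange]; exact hyQ
    rw [hGh w]; exact hf.2.2 w (hintF w hyF)
  -- ### the boundary slice atlas
  -- charts at the points of `F` (from the corner-slice charts)
  have hDF : ∀ x ∈ F, ∃ D : BoundarySliceChart 2 Q, x ∈ D.Θ.source ∧ D.Θ.source ⊆ U ∧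
      ∀ q ∈ D.Θ.source, D.Θ q 0 = va q := by
    intro x hx
    obtain ⟨C, hxC, hCU⟩ := hcorner x hx
    obtain ⟨D, hDsrc, hDcoord⟩ :=
      exists_boundarySliceChart_of_cornerSliceChart (Q := Q) C fun q hq => hQU q (hCU hq)
    refine ⟨D, by rw [hDsrc]; exact hxC, by rw [hDsrc]; exact hCU, fun q hq => ?_⟩
    rw [(hDcoord q).1, C.apply_one q (by rw [← hDsrc]; exact hq)]
  choose DF hDFmem hDFU hDF0 using hDF
  -- charts at the other points (from the immersion)
  have hDI : ∀ w : H, ∃ (D : BoundarySliceChart 2 Q) (φ : OpenPartialHomeomorph H (EuclideanHalfSpace 3)),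
      φ ∈ IsManifold.maximalAtlas (𝓡∂ 3) ∞ H ∧ h w ∈ D.Θ.source ∧
      ∀ w', h w' ∈ D.Θ.source → w' ∈ φ.source ∧
        (D.Θ (h w') 0 = 0 ↔ (𝓡∂ 3).IsBoundaryPoint w') ∧
        dropLast 2 (D.Θ (h w')) = φ.extend (𝓡∂ 3) w' := by
    intro w
    obtain ⟨D, φ, hφ, hwD, -, hprop⟩ :=
      exists_boundarySliceChart_of_isImmersionAt he hrange (himm w) isOpen_univ (mem_univ _)
    exact ⟨D, φ, hφ, hwD, hprop⟩
  choose DI φI hφI hDImem hDIprop using hDI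
  -- the preimage of a point of `Q`
  have hpre : ∀ p : ↥Q, ∃ w, h w = p.1 := fun p => by
    have : p.1 ∈ range h := by rw [hrange]; exact p.2
    exact this
  choose wOf hwOf using hpre
  -- the atlas
  set datum : ↥Q → BoundarySliceChart 2 Q :=
    fun p => if hp : p.1 ∈ F then DF p.1 hp else DI (wOf p) with hdatum
  have hdatumF : ∀ (p : ↥Q) (hp : p.1 ∈ F), datum p = DF p.1 hp := fun p hp => by
    simp only [hdatum, hp, dif_pos]
  have hdatumI : ∀ p : ↥Q, p.1 ∉ F → datum p = DI (wOf p) := fun p hp => by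
    simp only [hdatum, hp, dif_neg, not_false_eq_true]
  have hmem_source : ∀ p : ↥Q, p.1 ∈ (datum p).Θ.source := by
    intro p
    by_cases hp : p.1 ∈ F
    · rw [hdatumF p hp]; exact hDFmem p.1 hp
    · rw [hdatumI p hp, ← hwOf p]; exact hDImem (wOf p)
  set Φ : BoundarySliceAtlas 2 Q := ⟨datum, hmem_source⟩ with hΦ
  have hΦdatum : ∀ p, Φ.datum p = datum p := fun p => rfl
  -- boundary detection
  have hdetect : ∀ p : ↥Q, (Φ.datum p).Θ p.1 0 = 0 ↔ p.1 ∈ F := by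
    intro p
    rw [hΦdatum]
    by_cases hp : p.1 ∈ F
    · rw [hdatumF p hp, hDF0 p.1 hp p.1 (hDFmem p.1 hp), hvaF p.1 hp]
      exact ⟨fun _ => hp, fun _ => rfl⟩
    · rw [hdatumI p hp]
      have h1 := (hDIprop (wOf p) (wOf p) (hDImem (wOf p))).2.1
      rw [hwOf p] at h1
      rw [h1, hbdF, hwOf p]
  letI := Φ.chartedSpace
  haveI := Φ.isManifold
  -- ### Morse data
  -- transport at the points off `F`
  have htransport : ∀ w : H, h w ∉ F →
      (IsMCriticalPt (𝓡∂ 3) f w ↔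
        IsMCriticalPt (𝓡∂ 3) (G ∘ Subtype.val : ↥Q → ℝ) ⟨h w, hrange ▸ mem_range_self w⟩) ∧
      (IsMCriticalPt (𝓡∂ 3) f w →
        ((mhessian (𝓡∂ 3) f w).Nondegenerate ↔
          (mhessian (𝓡∂ 3) (G ∘ Subtype.val : ↥Q → ℝ) ⟨h w, hrange ▸ mem_range_self w⟩).Nondegenerate) ∧
        morseIndex (𝓡∂ 3) f w =
          morseIndex (𝓡∂ 3) (G ∘ Subtype.val : ↥Q → ℝ) ⟨h w, hrange ▸ mem_range_self w⟩) :=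
    fun w hw => morseData_face_transport hcont hrange Φ (DI w) (hφI w) (hintF w hw) (hDImem w)
      (fun w' hw' => ⟨(hDIprop w w' hw').1, (hDIprop w w' hw').2.2⟩) hfs hGs
      (fun w' _ => hGh w')
  -- no critical points on `F`
  have hnocritF : ∀ p : ↥Q, p.1 ∈ F → ¬ IsMCriticalPt (𝓡∂ 3) (G ∘ Subtype.val : ↥Q → ℝ) p := by
    intro p hp
    refine not_isMCriticalPt_face_boundary Φ p (va := va) (lam := lam) ?_ (hvaF p.1 hp) hGs hlams ?_
      (hlampos p.1 (hFOl hp)).ne'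
    · intro q hq
      rw [hΦdatum, hdatumF p hp] at hq ⊢
      exact hDF0 p.1 hp q hq
    · filter_upwards [hO₂o.mem_nhds (hFO₂ hp)] with y hy using hGO₂ y hy
  have hmorse : ∀ p : ↥Q, IsMCriticalPt (𝓡∂ 3) (G ∘ Subtype.val : ↥Q → ℝ) p →
      p.1 ∉ F ∧ (mhessian (𝓡∂ 3) (G ∘ Subtype.val : ↥Q → ℝ) p).Nondegenerate := by
    intro p hcrit
    have hp : p.1 ∉ F := fun hp => hnocritF p hp hcrit
    refine ⟨hp, ?_⟩
    have hpw : p = ⟨h (wOf p), hrange ▸ mem_range_self (wOf p)⟩ := Subtype.ext (hwOf p).symm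
    have hw : h (wOf p) ∉ F := by rw [hwOf p]; exact hp
    obtain ⟨h1, h2⟩ := htransport (wOf p) hw
    rw [hpw] at hcrit ⊢
    have hcritf : IsMCriticalPt (𝓡∂ 3) f (wOf p) := h1.2 hcrit
    exact ((h2 hcritf).1).1 (hf.1.2 _ hcritf)
  -- the counts
  have hcounts : ∀ n, (criticalSetOfIndex (𝓡∂ 3) (G ∘ Subtype.val : ↥Q → ℝ) n).ncard = c n := by
    intro n
    have hset : criticalSetOfIndex (𝓡∂ 3) (G ∘ Subtype.val : ↥Q → ℝ) n =
        (fun w => (⟨h w, hrange ▸ mem_range_self w⟩ : ↥Q)) '' criticalSetOfIndex (𝓡∂ 3) f n := by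
      ext p
      simp only [mem_criticalSetOfIndex, mem_image]
      constructor
      · rintro ⟨hcrit, hidx⟩
        have hp : p.1 ∉ F := (hmorse p hcrit).1
        have hpw : p = ⟨h (wOf p), hrange ▸ mem_range_self (wOf p)⟩ := Subtype.ext (hwOf p).symm
        have hw : h (wOf p) ∉ F := by rw [hwOf p]; exact hp
        obtain ⟨h1, h2⟩ := htransport (wOf p) hw
        rw [hpw] at hcrit hidx
        have hcritf : IsMCriticalPt (𝓡∂ 3) f (wOf p) := h1.2 hcrit
        refine ⟨wOf p, ⟨hcritf, ?_⟩, hpw.symm⟩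
        rw [(h2 hcritf).2]; exact hidx
      · rintro ⟨w, ⟨hcritf, hidx⟩, rfl⟩
        have hw : h w ∉ F := fun hwF => (hf.2.1 w ((hbdF w).2 hwF)).2 hcritf
        obtain ⟨h1, h2⟩ := htransport w hw
        exact ⟨h1.1 hcritf, by rw [← (h2 hcritf).2]; exact hidx⟩
    rw [hset, Set.ncard_image_of_injective _ (fun w w' hww' => hinj (congrArg Subtype.val hww')),
      hcount n]
  -- ### the normal form
  exact
    { isCompact := hQc
      F_subset := hFQ
      F_subset_U := hFU
      isOpen_U := hUo
      mem_iff := hQU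
      memF_iff := hmemF
      contMDiff_nrm := huas
      contMDiff_col := hvas
      morse := ⟨Φ, G, lam, O₂, hdetect, hGs, hlams, hO₂o, hFO₂,
        fun y hy => hOlU (hclO₂ (subset_closure hy)),
        fun y hy => hlampos y (hclO₂ (subset_closure hy)), hGO₂, hGlt, hmorse, hcounts⟩ }

/-- **The three faces of a Gay–Kirby trisection in normal form.**  Given the trisection and a
normal form of it (`TriNormalForm`, with frame `(u, v, U)`), the faces `S i ∩ S j`, `S j ∩ S l`,
`S l ∩ S i` are faces in normal form relative to the normal coordinates of the sectors `i`,
`j`, `l` respectively (face `(a, a⁺) = {u_a = 0, 0 ≤ v_a}`), with counts `handleCount 1 g`.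
[cite: GayKirby2016, Def. 1] -/
theorem IsGKTrisection.faceNormalForms {g : ℕ} {k : Fin 3 → ℕ} {S : Fin 3 → Set X}
    (h : IsGKTrisection X g k S) {i j l : Fin 3} {u v : X → ℝ} {ρ : X → X} {U O : Set X}
    {c : Fin 3 → ℕ → ℕ} (hT : TriNormalForm S i j l u v ρ U O c) :
    FaceNormalForm (S i ∩ S j) (⋂ m, S m) u v U (handleCount 1 g) ∧
    FaceNormalForm (S j ∩ S l) (⋂ m, S m) (fun y => v y - u y) (fun y => -u y) U (handleCount 1 g) ∧
    FaceNormalForm (S l ∩ S i) (⋂ m, S m) (fun y => -v y) (fun y => u y - v y) U (handleCount 1 g) := by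
  have hfr := hT.frame
  have hUo := hfr.isOpen_U
  have hu := hfr.contMDiff_u
  have hv := hfr.contMDiff_v
  have hFc := hfr.isCompact_F
  have hFU := hfr.F_subset_U
  have hF := hfr.memF_iff
  have hmi : ∀ y ∈ U, y ∈ S i ↔ 0 ≤ u y ∧ 0 ≤ v y := hT.sector_i.mem_iff
  have hmj := hT.mem_j
  have hml := hT.mem_l
  -- the generic step
  have face : ∀ {a b : Fin 3} (hab : a ≠ b) {ua va : X → ℝ} {Sa : Set X},
      ContMDiff (𝓡 4) 𝓘(ℝ, ℝ) ∞ ua → ContMDiff (𝓡 4) 𝓘(ℝ, ℝ) ∞ va →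
      (∀ y ∈ U, y ∈ (⋂ m, S m) ↔ ua y = 0 ∧ va y = 0) →
      (∀ y ∈ U, y ∈ S a ∩ S b ↔ ua y = 0 ∧ 0 ≤ va y) →
      (∀ x ∈ ⋂ m, S m, ∃ C : CornerSliceChart Sa (⋂ m, S m) ua va ρ, x ∈ C.Θ.source ∧ C.Θ.source ⊆ U) →
      FaceNormalForm (S a ∩ S b) (⋂ m, S m) ua va U (handleCount 1 g) := by
    intro a b hab ua va Sa huas hvas hmemF hQU hcorner
    obtain ⟨H, _, _, hmap, hM, hHc, -, hHD, hemb, hrange, hbd⟩ := h.2.2 a b hab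
    haveI := hM
    haveI := hHc
    exact exists_faceNormalForm hUo huas hvas hFc hFU hmemF hQU hcorner hemb hrange hbd hHD
  refine ⟨face (Sa := S i) hT.ne_ij hu hv hF (fun y hy => ?_) (fun x hx => ?_),
    face (Sa := S j) hT.ne_jl (hv.sub hu) hu.neg (fun y hy => ?_) (fun y hy => ?_) (fun x hx => ?_),
    face (Sa := S l) hT.ne_il.symm hv.neg (hu.sub hv) (fun y hy => ?_) (fun y hy => ?_) (fun x hx => ?_)⟩
  · rw [mem_inter_iff, hmi y hy, hmj y hy]
    constructor
    · rintro ⟨⟨h1, h2⟩, h3, -⟩; exact ⟨le_antisymm h3 h1, h2⟩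
    · rintro ⟨h1, h2⟩; exact ⟨⟨h1.ge, h2⟩, h1.le, by rw [h1]; exact h2⟩
  · obtain ⟨C, hxC, hCO⟩ := hT.sector_i.corner x hx
    exact ⟨C, hxC, hCO.trans hfr.O_subset_U⟩
  · rw [hF y hy]; constructor <;> intro h' <;> constructor <;> linarith [h'.1, h'.2]
  · rw [mem_inter_iff, hmj y hy, hml y hy]
    constructor
    · rintro ⟨⟨h1, h2⟩, h3, h4⟩; constructor <;> linarith
    · rintro ⟨h1, h2⟩; refine ⟨⟨?_, ?_⟩, ?_, ?_⟩ <;> linarith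
  · obtain ⟨C, hxC, hCO⟩ := hT.sector_j.corner x hx
    exact ⟨C, hxC, hCO.trans hfr.O_subset_U⟩
  · rw [hF y hy]; constructor <;> intro h' <;> constructor <;> linarith [h'.1, h'.2]
  · rw [mem_inter_iff, hml y hy, hmi y hy]
    constructor
    · rintro ⟨⟨h1, h2⟩, h3, h4⟩; constructor <;> linarith
    · rintro ⟨h1, h2⟩; refine ⟨⟨?_, ?_⟩, ?_, ?_⟩ <;> linarith
  · obtain ⟨C, hxC, hCO⟩ := hT.sector_l.corner x hx
    exact ⟨C, hxC, hCO.trans hfr.O_subset_U⟩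

end FaceFromGK

end Literature.Topology.FourManifolds
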